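import Summits.AnomalousDissipation.AnomalousDissipation.Theorems.SolenoidalFractalHomogenisationLagrangianStepMeanZero
import Summits.AnomalousDissipation.AnomalousDissipation.Theorems.SolenoidalFractalHomogenisationLagrangianStepZBlock
import Summits.AnomalousDissipation.AnomalousDissipation.Theorems.SolenoidalFractalHomogenisationLagrangianStepHighLabelKill
import Summits.AnomalousDissipation.AnomalousDissipation.Theorems.SolenoidalFractalHomogenisationLagrangianStepTemplateSuperSmallHiTails
import Summits.AnomalousDissipation.AnomalousDissipation.Theorems.SolenoidalFractalHomogenisationLagrangianStepOneLevelGlueLowerFamily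
import Summits.AnomalousDissipation.AnomalousDissipation.Theorems.SolenoidalFractalHomogenisationLagrangianStepOneLevelSplitDefsH
import HarnessLib

/-!
# K1L_D (stmt-AnomalousDissipation-27980): the FINAL ASSEMBLY of `stub_windowFactsH` from its two input texts — `windowFactsH_of_inputs`
# (helper; `--supports … --as helper`; lead-k1l-onelevel-p1 g3)

Registry v8 (tenure ad-ideate-p1, sha16 9e2ed75e7b2714ff) holds `stub_windowFactsH` (XL−, this seat): the orthogonal three-way label splitting
`P ⊕ Q₁ ⊕ Q₂` of `V2 = L²(𝕋³;ℝ³)` and, on every grid window, the operator facts (Z) (dissipation-weighted duality bound of the low-label window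
error), (Hi) (the coarse map and its adjoint kill the classes `Q₁ ⊕ Q₂` up to the super-small slop `ε`) and (Rec) (six transfer bounds).  THIS FILE
reduces it, sorry-free, to the two INPUT TEXTS of the crux workfile `Cruxes/LagrangianRenormalisationStep/Lines/onelevel_S23_split.lean` (v28):
* §4c `stub_effectiveFrameEnergyL` (W3-E, holder ad-k3l-bookkeeping-p1; propagator level, physical coordinates): (i) the dissipation bound and
  (ii-out)/(ii-in) the band kill with engine-A tail, for `Um s s'` and its adjoint on windows of length `≤ 2·refresh(m+1)` under `θ(m+1) ≤ θ₁`;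
* §9 `cellInputs_text` (W4/W5/W6/(X_G⁺)/(M♭_G)): the frequency classes `A, B, C`, and for the label projectors they characterise, per grid
  window, (Zin) the four `z_of_pieces` pieces of `P(Uu − Tu)` and (Recin) the six transfer bounds at one small scale `ηz = Cz ρ^σz`.
Assembly: `Cw := 10·Cz`, `σw := σz`; `P, Q₁, Q₂ := exists_labelSplit A B C` (…LabelSplit), `Q₂ x₁ = 0` by `labelProj_datum_eq_zero`; (Hi) by
`hi_of_bandKill` (…HighLabelKill) at levels `L = Lc/2`, `L' = L/2` with the tail `≤ ε` by `hi_tails_le_eps` (…TemplateSuperSmallHiTails) once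
`θ(m+1) ≤ θ₁` ((T4) + `sep16 → ∞`); (Z) by `z_block` (…ZBlock: `z_of_pieces` + `floor_meanfree`) with the zero modes discharged by
`fcoeff_zero_apply_eq` (…MeanZero) and the off-ball saturation `rate_k·τ ≥ 1` for `|k| > Lc/2` (`off_ball_rate_ge_one`, from `e1_exponent_ge`);
(Rec) from (Recin) by `ηz ≤ ηm`.  The conclusion is the registered text of `stub_windowFactsH` BYTE-FOR-BYTE (the registry discharges the stub by
`windowFactsH_of_inputs stub_effectiveFrameEnergyL stub_cellInputs` once the two inputs are registered stubs / landed).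
NOT a proof of the two inputs, of the crux `LagrangianRenormalisationStepDesign`, or of anomalous dissipation; rung F-D1.A0.
-/

set_option linter.dupNamespace false

noncomputable section

namespace Summit.AnomalousDissipation.AnomalousDissipation.Theorems.SolenoidalFractalHomogenisation.LagrangianStep

open Literature.Analysis Literature.Analysis.FluidPDE Literature.Analysis.FunctionSpaces
open MeasureTheory Set Filter ContinuousLinearMap UnitAddTorus
open scoped ENNReal NNReal InnerProductSpace Classical
open Literature.Analysis.FluidPDE.LatticeShear
open Summit.AnomalousDissipation.AnomalousDissipation.Theorems.SolenoidalFractalHomogenisation.RealisedQuasiStaticCellLaw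
open Summit.AnomalousDissipation.AnomalousDissipation.Theorems.SolenoidalFractalHomogenisation.LagrangianRenormalisationStep
open Summit.AnomalousDissipation.AnomalousDissipation.Theorems.SolenoidalFractalHomogenisation.PermissibleCarrier (period_pos)
open OneLevelSplit

/-! ## Off the slow ball every mode is dissipated within one refresh window -/

/-- **Off-ball saturation.**  Eventually in `m`, for every `τ ≥ refresh(m+1)` and the pinned trim level `Lcap`, every frequency outside
`freqBall (Lcap/2)` has `rate_k · τ ≥ 1` (`rate_k = a·8π²|k|²·lo·(ν + c/ν)/n²`): `|k| > Lcap/2 ≥ Lcap/4 ≥ X/8` and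
`rate(X/8)·τ ≥ (π²/8)·lo·M·W.period·s_m^(1/2)` (`e1_exponent_ge`) with `s_m → ∞`. -/
theorem off_ball_rate_ge_one {k : ℕ} (E : LagrangianLatticeCarrier k) {W : LatticeWord k} {M : ℝ} {hM : 0 < M}
    (hW : E.design = W.stretch M hM) (hL : E.LPermissible) (hsq : ∀ m, E.N m ^ 2 ≤ E.N (m + 1))
    (hT3 : ∀ m, E.K * ((E.N (m + 1) : ℝ) / E.N m) ^ (1 / 4 : ℝ) ≤ ((E.N (m + 1) : ℝ) / E.N m) * E.cellVisc (m + 1))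
    (hT5 : ∀ m, ((E.N (m + 1) : ℝ) / E.N m) ^ (1 / 16 : ℝ) * E.physPeriod (m + 1) ≤ E.refresh (m + 1))
    {lo c : ℝ} (hlo : 0 < lo) (hc : 0 < c) :
    ∃ mstar : ℕ, ∀ m, mstar ≤ m → ∀ τ : ℝ, E.refresh (m + 1) ≤ τ →
      ∀ Lcap : ℕ, Lcap = ⌊((E.N m : ℝ) / E.N (m + 1)) ^ (1 / 64 : ℝ) * ((E.N (m + 1) : ℝ) * E.cellVisc (m + 1)) / Real.sqrt c⌋₊ →
      ∀ k' : Fin 3 → ℤ, k' ∉ Torus.freqBall (Lcap / 2) →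
        1 ≤ E.a (m + 1) * (8 * Real.pi ^ 2 * ‖Torus.latticeVec k'‖ ^ 2 * lo * (E.cellVisc (m + 1) + c / E.cellVisc (m + 1))
          / (E.N (m + 1) : ℝ) ^ 2) * τ := by
  have hP : E.toFractalCarrierData.Permissible := hL.1
  have hK : 0 < E.K := E.K_pos
  have hsc : 0 < Real.sqrt c := Real.sqrt_pos.2 hc
  have hWp : 0 < W.period := period_pos W
  obtain ⟨mX, hmX⟩ := exists_forall_le_sep16 E.toFractalCarrierData hP hsq (8 * Real.sqrt c / E.K)
  obtain ⟨mR, hmR⟩ := exists_forall_le_sep16 E.toFractalCarrierData hP hsq ((8 / (Real.pi ^ 2 * lo * (M * W.period))) ^ 2)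
  refine ⟨max mX mR, fun m hm τ hτ Lcap hLcap k' hk' => ?_⟩
  have hmX' := hmX m (le_trans (le_max_left _ _) hm)
  have hmR' := hmR m (le_trans (le_max_right _ _) hm)
  set s : ℝ := ((E.N (m + 1) : ℝ) / E.N m) ^ (1 / 16 : ℝ) with hs_def
  have hs1 : 1 ≤ s := one_le_sep16 E.toFractalCarrierData hP m
  have hs0 : 0 < s := by linarith
  have hN1 : (1 : ℝ) ≤ E.N m := by exact_mod_cast E.N_pos m
  -- `X ≥ 8`
  set X : ℝ := ((E.N m : ℝ) / E.N (m + 1)) ^ (1 / 64 : ℝ) * ((E.N (m + 1) : ℝ) * E.cellVisc (m + 1)) / Real.sqrt c with hX_def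
  have hX1 : E.K / Real.sqrt c * s ^ (15 / 4 : ℝ) * E.N m ≤ X := cap_arg_ge_mul_N E.toFractalCarrierData hT3 hc m
  have hs154 : s ≤ s ^ (15 / 4 : ℝ) := by
    conv_lhs => rw [← Real.rpow_one s]
    exact Real.rpow_le_rpow_of_exponent_le hs1 (by norm_num)
  have hX8 : 8 ≤ X := by
    have h1 : 8 * Real.sqrt c / E.K ≤ s := hmX'
    have h2 : 8 ≤ E.K / Real.sqrt c * s := by
      rw [div_le_iff₀ hK] at h1; rw [div_mul_eq_mul_div, le_div_iff₀ hsc]; linarith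
    have h3 : E.K / Real.sqrt c * s ≤ E.K / Real.sqrt c * s ^ (15 / 4 : ℝ) * E.N m := by
      have := mul_le_mul (mul_le_mul_of_nonneg_left hs154 (by positivity : 0 ≤ E.K / Real.sqrt c)) hN1 zero_le_one
        (by positivity)
      simpa using this
    linarith
  obtain ⟨hL'ge, -, -⟩ := band_levels hX8 hLcap (rfl : Lcap / 2 = Lcap / 2) (rfl : Lcap / 2 / 2 = Lcap / 2 / 2)
  -- `rate(L')·τ ≥ (π²/8)·lo·M·Wp·s^(1/2) ≥ 1`
  have he1 := e1_exponent_ge E hW hT5 hlo hc m (L' := Lcap / 2 / 2) (by rw [← hX_def]; linarith) hτ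
  have hroot : 8 / (Real.pi ^ 2 * lo * (M * W.period)) ≤ s ^ (1 / 2 : ℝ) := by
    rw [← Real.sqrt_eq_rpow]
    exact le_trans (le_abs_self _) (Real.abs_le_sqrt hmR')
  have hpos : 0 < Real.pi ^ 2 * lo * (M * W.period) := by positivity
  have hrate1 : 1 ≤ E.a (m + 1) * (8 * Real.pi ^ 2 * ((Lcap / 2 / 2 : ℕ) : ℝ) ^ 2 * lo * (E.cellVisc (m + 1) + c / E.cellVisc (m + 1))
      / (E.N (m + 1) : ℝ) ^ 2) * τ := by
    have h1 : Real.pi ^ 2 / 16 * lo * (M * W.period) * (8 / (Real.pi ^ 2 * lo * (M * W.period))) = 1 / 2 := by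
      field_simp; ring
    have h2 : 1 / 2 ≤ Real.pi ^ 2 / 16 * lo * (M * W.period) * s ^ (1 / 2 : ℝ) :=
      calc (1 / 2 : ℝ) = Real.pi ^ 2 / 16 * lo * (M * W.period) * (8 / (Real.pi ^ 2 * lo * (M * W.period))) := h1.symm
        _ ≤ Real.pi ^ 2 / 16 * lo * (M * W.period) * s ^ (1 / 2 : ℝ) := mul_le_mul_of_nonneg_left hroot (by positivity)
    linarith
  -- monotonicity in the frequency: `|k'|² ≥ (Lcap/2)² ≥ (Lcap/4)²`
  have hν : 0 < E.cellVisc (m + 1) := cellVisc_pos' E.toFractalCarrierData (m + 1)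
  have hk2 : ((Lcap / 2 / 2 : ℕ) : ℝ) ^ 2 ≤ ‖Torus.latticeVec k'‖ ^ 2 := by
    rw [Torus.norm_latticeVec_sq]
    rw [Torus.mem_freqBall, not_le] at hk'
    have hle : ((Lcap / 2 / 2 : ℕ) : ℝ) ≤ ((Lcap / 2 : ℕ) : ℝ) := by exact_mod_cast Nat.div_le_self (Lcap / 2) 2
    have hle2 : ((Lcap / 2 / 2 : ℕ) : ℝ) ^ 2 ≤ ((Lcap / 2 : ℕ) : ℝ) ^ 2 := pow_le_pow_left₀ (Nat.cast_nonneg _) hle 2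
    linarith
  have hτ0 : 0 ≤ τ := le_trans (E.refresh_pos (m + 1)).le hτ
  calc (1 : ℝ) ≤ E.a (m + 1) * (8 * Real.pi ^ 2 * ((Lcap / 2 / 2 : ℕ) : ℝ) ^ 2 * lo * (E.cellVisc (m + 1) + c / E.cellVisc (m + 1))
      / (E.N (m + 1) : ℝ) ^ 2) * τ := hrate1
    _ ≤ E.a (m + 1) * (8 * Real.pi ^ 2 * ‖Torus.latticeVec k'‖ ^ 2 * lo * (E.cellVisc (m + 1) + c / E.cellVisc (m + 1))
      / (E.N (m + 1) : ℝ) ^ 2) * τ := by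
        have ha : 0 ≤ E.a (m + 1) := (E.a_pos (m + 1)).le
        gcongr

/-! ## The assembly -/

set_option maxHeartbeats 1600000 in
/-- **`stub_windowFactsH` from its two input texts.**  See the module docstring.  Hypotheses: the §4c text (W3-E) and the §9 text (cell-side
operator inputs) of split v28, verbatim; conclusion: the registered text of `stub_windowFactsH` (registry v6′/v8), verbatim. -/
theorem windowFactsH_of_inputs
    (hW3E : ∀ k (W : Literature.Analysis.FluidPDE.LatticeShear.LatticeWord k) (M : ℝ) (hM : 0 < M) (c : ℝ), 0 < c →
    ∀ (Φ : ℝ → Torus.Visc4 (Fin 3) → Torus.Visc4 (Fin 3)) (lo hi β : ℝ), 0 < lo → lo ≤ 1 → 1 ≤ hi → 0 ≤ β →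
      ∃ C₂ : ℝ, 1 ≤ C₂ ∧ ∃ θ₁ > (0:ℝ), ∃ c₃ > (0:ℝ),
        ∀ E : Literature.Analysis.FluidPDE.LatticeShear.LagrangianLatticeCarrier k, E.design = W.stretch M hM → E.gain = c →
          E.LPermissible → E.Regular →
        ∀ (m : ℕ), E.θ (m + 1) ≤ θ₁ →
        ∀ (S : Torus.Visc4 (Fin 3)), Torus.OddSmall (Φ (E.cellVisc (m + 1)) S) β → Torus.NearIso (Φ (E.cellVisc (m + 1)) S) lo hi →
        ∀ Um : ℝ → ℝ → (V2 →L[ℝ] V2),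
          Torus.IsPropagator 1 (E.partialSum m) (E.kbar m • renormStep (Φ (E.cellVisc (m + 1))) (E.gain / E.cellVisc (m + 1) ^ 2) S) Um →
        ∀ (s s' : ℝ), 0 ≤ s → s ≤ s' → s' ≤ 1 → s' - s ≤ 2 * E.refresh (m + 1) →
        ∀ T : V2 →L[ℝ] V2, (T = Um s s' ∨ T = ContinuousLinearMap.adjoint (Um s s')) →
          -- (i) dissipation floor: the surviving energy loses at least half of the dissipation-weighted spectrum
          (∀ y : V2, ‖T y‖ ^ 2 ≤ ‖y‖ ^ 2 - 1 / 2 * ∑' k' : Fin 3 → ℤ,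
              min 1 (E.a (m + 1) * (8 * Real.pi ^ 2 * ‖Torus.latticeVec k'‖ ^ 2 * lo * (E.cellVisc (m + 1) + c / E.cellVisc (m + 1))
                / (E.N (m + 1) : ℝ) ^ 2) * (s' - s))
              * ‖UnitAddTorus.mFourierCoeff (EuclideanSpace.complexify ∘ ⇑y) k'‖ ^ 2) ∧
          -- (ii-out) band kill, output form (NORM form, factor gap), ENGINE-A currency: one factor-2 climb costs `e^(−c₃/θ(m+1))` (thin geometric
          -- bands, p4 21:08:07Z) and the additive-hop branch `e^(−(L−L')/(C₂ N_m))`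
          (∀ L' L : ℕ, 2 * L' ≤ L → ∀ y : V2,
              ‖T y - cutLp L (T y)‖
                ≤ Real.exp (-(E.a (m + 1) * (8 * Real.pi ^ 2 * (L' : ℝ) ^ 2 * lo * (E.cellVisc (m + 1) + c / E.cellVisc (m + 1))
                    / (E.N (m + 1) : ℝ) ^ 2) * (s' - s) / 2)) * ‖y - cutLp L' y‖
                  + (Real.exp (-(c₃ / E.θ (m + 1))) + Real.exp (-(((L : ℝ) - L') / (C₂ * E.N m)))) * ‖y‖) ∧
          -- (ii-in) band kill, input form (NORM form, factor gap), engine-A currency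
          (∀ L' L : ℕ, 2 * L' ≤ L → ∀ y : V2, cutLp L y = 0 →
              ‖T y‖
                ≤ (Real.exp (-(E.a (m + 1) * (8 * Real.pi ^ 2 * (L' : ℝ) ^ 2 * lo * (E.cellVisc (m + 1) + c / E.cellVisc (m + 1))
                    / (E.N (m + 1) : ℝ) ^ 2) * (s' - s) / 2))
                  + (Real.exp (-(c₃ / E.θ (m + 1))) + Real.exp (-(((L : ℝ) - L') / (C₂ * E.N m))))) * ‖y‖))
    (hCell : ∀ k (W : Literature.Analysis.FluidPDE.LatticeShear.LatticeWord k) (M : ℝ) (hM : 0 < M) (c : ℝ), 0 < c →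
    ∀ (Φ : ℝ → Torus.Visc4 (Fin 3) → Torus.Visc4 (Fin 3)) (lo hi Λ β σ C ν₀ K Cf νf Kf : ℝ),
      0 < lo → lo ≤ 1 → 1 ≤ hi → 1 < Λ → 0 ≤ β →
      0 < σ → 0 ≤ C → 0 < ν₀ → 0 < K → SlowVectorClauseF W M hM c Φ lo hi Λ β σ C ν₀ K →
      0 ≤ Cf → 0 < νf → 0 < Kf → CellEnergyClausesW W M hM c lo hi Λ β Cf νf Kf →
      (∀ Kb : ℝ, 1 ≤ Kb → ∃ CK : ℝ, 1 ≤ CK ∧ ∃ cK > (0:ℝ), ∃ νh > (0:ℝ), HighLabelDecayW W M hM lo hi Λ β νh Kb CK cK) →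
      ∃ ν₁ > (0:ℝ), ∃ K₁ > (0:ℝ), ∃ Λ₀ : ℕ, ∃ θ₀ > (0:ℝ), ∃ Cz > (0:ℝ), ∃ σz > (0:ℝ),
        ∀ E : Literature.Analysis.FluidPDE.LatticeShear.LagrangianLatticeCarrier k, E.design = W.stretch M hM → E.gain = c → E.nu0 ≤ ν₁ → K₁ ≤ E.K →
          E.LPermissible → E.Regular → (∀ m, Λ₀ * E.N m ≤ E.N (m + 1)) → (∀ m, E.N m ^ 2 ≤ E.N (m + 1)) →
          (∀ m, E.cellVisc (m + 1) * ((E.N (m + 1) : ℝ) / E.N m) ^ (1 / 4 : ℝ) ≤ 1) →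
          (∀ m, E.K * ((E.N (m + 1) : ℝ) / E.N m) ^ (1 / 4 : ℝ) ≤ ((E.N (m + 1) : ℝ) / E.N m) * E.cellVisc (m + 1)) →
          (∀ m, E.θ (m + 1) * ((E.N (m + 1) : ℝ) / E.N m) ^ (1 / 16 : ℝ) ≤ θ₀) →
          (∀ m, ((E.N (m + 1) : ℝ) / E.N m) ^ (1 / 16 : ℝ) * E.physPeriod (m + 1) ≤ E.refresh (m + 1)) →
        ∃ mstar : ℕ, ∀ m, mstar ≤ m →
          E.refresh (m + 1) ≤ 1 / 4 ∧
          ∀ Lc : ℕ, Lc = ⌊((E.N m : ℝ) / E.N (m + 1)) ^ (1 / 64 : ℝ) * (E.N (m + 1) * E.cellVisc (m + 1)) / Real.sqrt c⌋₊ →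
          ∀ S : Torus.Visc4 (Fin 3), Torus.OddSmall S β → Torus.NearIso S lo hi →
            Torus.OddSmall (Φ (E.cellVisc (m + 1)) S) β → Torus.NearIso (Φ (E.cellVisc (m + 1)) S) lo hi →
          ∀ Um Um1 : ℝ → ℝ → (V2 →L[ℝ] V2),
            Torus.IsPropagator 1 (E.partialSum m) (E.kbar m • renormStep (Φ (E.cellVisc (m + 1))) (E.gain / E.cellVisc (m + 1) ^ 2) S) Um →
            Torus.IsPropagator 1 (E.partialSum (m + 1)) (E.kbar (m + 1) • S) Um1 →
          ∀ ηz ε : ℝ, ηz = Cz * ((E.N m : ℝ) / E.N (m + 1)) ^ σz →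
            ε = ((E.N m : ℝ) / E.N (m + 1)) ^ σz * (1 - Real.exp (-(4 * Real.pi ^ 2 * (E.kbar m * lo)))) * E.refresh (m + 1) →
          ∃ A B C : Set (Fin 3 → ℤ),
            (∀ k', k' ∈ A ↔ -k' ∈ A) ∧ (∀ k', k' ∈ B ↔ -k' ∈ B) ∧ (∀ k', k' ∈ C ↔ -k' ∈ C) ∧
            (∀ k', k' ∈ A → k' ∉ B) ∧ (∀ k', k' ∈ A → k' ∉ C) ∧ (∀ k', k' ∈ B → k' ∉ C) ∧ (∀ k', k' ∈ A ∨ k' ∈ B ∨ k' ∈ C) ∧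
            (∀ k', k' ∈ B ∨ k' ∈ C → (((Lc / 2 : ℕ) : ℝ)) ^ 2 < Torus.freqNormSq k') ∧ (∀ k', k' ∈ C → ((Lc : ℝ)) ^ 2 < Torus.freqNormSq k') ∧
          ∀ P Q₁ Q₂ : V2 →L[ℝ] V2,
            (∀ (y : V2) (k' : Fin 3 → ℤ), UnitAddTorus.mFourierCoeff (EuclideanSpace.complexify ∘ ⇑(P y)) k' = if k' ∈ A then UnitAddTorus.mFourierCoeff (EuclideanSpace.complexify ∘ ⇑(y)) k' else 0) →
            (∀ (y : V2) (k' : Fin 3 → ℤ), UnitAddTorus.mFourierCoeff (EuclideanSpace.complexify ∘ ⇑(Q₁ y)) k' = if k' ∈ B then UnitAddTorus.mFourierCoeff (EuclideanSpace.complexify ∘ ⇑(y)) k' else 0) →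
            (∀ (y : V2) (k' : Fin 3 → ℤ), UnitAddTorus.mFourierCoeff (EuclideanSpace.complexify ∘ ⇑(Q₂ y)) k' = if k' ∈ C then UnitAddTorus.mFourierCoeff (EuclideanSpace.complexify ∘ ⇑(y)) k' else 0) →
          ∀ (w₁ : VF) (hw₁ : IsDatum w₁), Torus.fourierTruncate Lc w₁ = w₁ →
            ∀ (j : ℕ) (s' : ℝ), (j : ℝ) * E.refresh (m + 1) + E.refresh (m + 1) ≤ s' →
              s' ≤ (j : ℝ) * E.refresh (m + 1) + 2 * E.refresh (m + 1) → s' ≤ 1 →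
              -- (Zin) the low-label window error splits into the four pieces of `z_of_pieces` (diag W6 · cross (X_G⁺) · leak W5 · fast W5⊕(M♭_G))
              (∃ e_d e_c e_l e_f : V2,
                P (Um1 ((j : ℝ) * E.refresh (m + 1)) s' (Um1 0 ((j : ℝ) * E.refresh (m + 1)) (datumLp w₁ hw₁)) - Um ((j : ℝ) * E.refresh (m + 1)) s' (Um1 0 ((j : ℝ) * E.refresh (m + 1)) (datumLp w₁ hw₁))) = e_d + e_c + e_l + e_f ∧
                (∀ k', k' ∉ ((Torus.freqBall (Lc / 2)).erase 0) → UnitAddTorus.mFourierCoeff (EuclideanSpace.complexify ∘ ⇑(e_d)) k' = 0) ∧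
                (∀ k', k' ∉ ((Torus.freqBall (Lc / 2)).erase 0) → UnitAddTorus.mFourierCoeff (EuclideanSpace.complexify ∘ ⇑(e_l)) k' = 0) ∧
                (∀ k', k' ∈ ((Torus.freqBall (Lc / 2)).erase 0) → UnitAddTorus.mFourierCoeff (EuclideanSpace.complexify ∘ ⇑(e_f)) k' = 0) ∧
                (∀ k', k' ∈ ((Torus.freqBall (Lc / 2)).erase 0) →
                  ‖UnitAddTorus.mFourierCoeff (EuclideanSpace.complexify ∘ ⇑(e_d)) k'‖ ≤ ηz * min 1 ((E.a (m + 1) * (8 * Real.pi ^ 2 * ‖Torus.latticeVec k'‖ ^ 2 * lo * (E.cellVisc (m + 1) + c / E.cellVisc (m + 1)) / (E.N (m + 1) : ℝ) ^ 2)) * (s' - (j : ℝ) * E.refresh (m + 1))) * ‖UnitAddTorus.mFourierCoeff (EuclideanSpace.complexify ∘ ⇑(Um1 0 ((j : ℝ) * E.refresh (m + 1)) (datumLp w₁ hw₁))) k'‖) ∧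
                (∀ y : V2, |⟪y, e_c⟫_ℝ| ≤ ηz
                  * Real.sqrt (∑ k' ∈ ((Torus.freqBall (Lc / 2)).erase 0), min 1 ((E.a (m + 1) * (8 * Real.pi ^ 2 * ‖Torus.latticeVec k'‖ ^ 2 * lo * (E.cellVisc (m + 1) + c / E.cellVisc (m + 1)) / (E.N (m + 1) : ℝ) ^ 2)) * (s' - (j : ℝ) * E.refresh (m + 1))) * ‖UnitAddTorus.mFourierCoeff (EuclideanSpace.complexify ∘ ⇑(Um1 0 ((j : ℝ) * E.refresh (m + 1)) (datumLp w₁ hw₁))) k'‖ ^ 2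
                      + (‖Um1 0 ((j : ℝ) * E.refresh (m + 1)) (datumLp w₁ hw₁)‖ ^ 2 - ∑ k' ∈ ((Torus.freqBall (Lc / 2)).erase 0), ‖UnitAddTorus.mFourierCoeff (EuclideanSpace.complexify ∘ ⇑(Um1 0 ((j : ℝ) * E.refresh (m + 1)) (datumLp w₁ hw₁))) k'‖ ^ 2))
                  * Real.sqrt (∑ k' ∈ ((Torus.freqBall (Lc / 2)).erase 0), min 1 ((E.a (m + 1) * (8 * Real.pi ^ 2 * ‖Torus.latticeVec k'‖ ^ 2 * lo * (E.cellVisc (m + 1) + c / E.cellVisc (m + 1)) / (E.N (m + 1) : ℝ) ^ 2)) * (s' - (j : ℝ) * E.refresh (m + 1))) * ‖UnitAddTorus.mFourierCoeff (EuclideanSpace.complexify ∘ ⇑(y)) k'‖ ^ 2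
                      + (‖y‖ ^ 2 - ∑ k' ∈ ((Torus.freqBall (Lc / 2)).erase 0), ‖UnitAddTorus.mFourierCoeff (EuclideanSpace.complexify ∘ ⇑(y)) k'‖ ^ 2))) ∧
                (∑ k' ∈ ((Torus.freqBall (Lc / 2)).erase 0), ‖UnitAddTorus.mFourierCoeff (EuclideanSpace.complexify ∘ ⇑(e_l)) k'‖ ^ 2 / (ηz ^ 2 * min 1 ((E.a (m + 1) * (8 * Real.pi ^ 2 * ‖Torus.latticeVec k'‖ ^ 2 * lo * (E.cellVisc (m + 1) + c / E.cellVisc (m + 1)) / (E.N (m + 1) : ℝ) ^ 2)) * (s' - (j : ℝ) * E.refresh (m + 1))))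
                  ≤ ‖Um1 0 ((j : ℝ) * E.refresh (m + 1)) (datumLp w₁ hw₁)‖ ^ 2 - ∑ k' ∈ ((Torus.freqBall (Lc / 2)).erase 0), ‖UnitAddTorus.mFourierCoeff (EuclideanSpace.complexify ∘ ⇑(Um1 0 ((j : ℝ) * E.refresh (m + 1)) (datumLp w₁ hw₁))) k'‖ ^ 2) ∧
                ‖e_f‖ ≤ Real.sqrt (∑ k' ∈ ((Torus.freqBall (Lc / 2)).erase 0), ηz ^ 2 * min 1 ((E.a (m + 1) * (8 * Real.pi ^ 2 * ‖Torus.latticeVec k'‖ ^ 2 * lo * (E.cellVisc (m + 1) + c / E.cellVisc (m + 1)) / (E.N (m + 1) : ℝ) ^ 2)) * (s' - (j : ℝ) * E.refresh (m + 1))) * ‖UnitAddTorus.mFourierCoeff (EuclideanSpace.complexify ∘ ⇑(Um1 0 ((j : ℝ) * E.refresh (m + 1)) (datumLp w₁ hw₁))) k'‖ ^ 2)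
                  + ηz * Real.sqrt (‖Um1 0 ((j : ℝ) * E.refresh (m + 1)) (datumLp w₁ hw₁)‖ ^ 2 - ∑ k' ∈ ((Torus.freqBall (Lc / 2)).erase 0), ‖UnitAddTorus.mFourierCoeff (EuclideanSpace.complexify ∘ ⇑(Um1 0 ((j : ℝ) * E.refresh (m + 1)) (datumLp w₁ hw₁))) k'‖ ^ 2)) ∧
              -- (Recin) the 3×3 high-label transfer bounds of the true window map (W4/W5/W6/(M♭_G))
              ‖Q₁ (Um1 ((j : ℝ) * E.refresh (m + 1)) s' (P (Um1 0 ((j : ℝ) * E.refresh (m + 1)) (datumLp w₁ hw₁))))‖ ≤ Real.sqrt (ηz * (‖Um1 0 ((j : ℝ) * E.refresh (m + 1)) (datumLp w₁ hw₁)‖ ^ 2 - ‖Um ((j : ℝ) * E.refresh (m + 1)) s' (Um1 0 ((j : ℝ) * E.refresh (m + 1)) (datumLp w₁ hw₁))‖ ^ 2)) + ε * ‖datumLp w₁ hw₁‖ ∧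
              ‖Q₂ (Um1 ((j : ℝ) * E.refresh (m + 1)) s' (P (Um1 0 ((j : ℝ) * E.refresh (m + 1)) (datumLp w₁ hw₁))))‖ ≤ Real.sqrt (ηz * (‖Um1 0 ((j : ℝ) * E.refresh (m + 1)) (datumLp w₁ hw₁)‖ ^ 2 - ‖Um ((j : ℝ) * E.refresh (m + 1)) s' (Um1 0 ((j : ℝ) * E.refresh (m + 1)) (datumLp w₁ hw₁))‖ ^ 2)) + ε * ‖datumLp w₁ hw₁‖ ∧
              ‖Q₁ (Um1 ((j : ℝ) * E.refresh (m + 1)) s' (Q₁ (Um1 0 ((j : ℝ) * E.refresh (m + 1)) (datumLp w₁ hw₁))))‖ ≤ ηz * ‖Q₁ (Um1 0 ((j : ℝ) * E.refresh (m + 1)) (datumLp w₁ hw₁))‖ + ε * ‖datumLp w₁ hw₁‖ ∧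
              ‖Q₂ (Um1 ((j : ℝ) * E.refresh (m + 1)) s' (Q₁ (Um1 0 ((j : ℝ) * E.refresh (m + 1)) (datumLp w₁ hw₁))))‖ ≤ ηz * ‖Q₁ (Um1 0 ((j : ℝ) * E.refresh (m + 1)) (datumLp w₁ hw₁))‖ + ε * ‖datumLp w₁ hw₁‖ ∧
              ‖Q₁ (Um1 ((j : ℝ) * E.refresh (m + 1)) s' (Q₂ (Um1 0 ((j : ℝ) * E.refresh (m + 1)) (datumLp w₁ hw₁))))‖ ≤ ηz * ‖Q₂ (Um1 0 ((j : ℝ) * E.refresh (m + 1)) (datumLp w₁ hw₁))‖ + ε * ‖datumLp w₁ hw₁‖ ∧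
              ‖Q₂ (Um1 ((j : ℝ) * E.refresh (m + 1)) s' (Q₂ (Um1 0 ((j : ℝ) * E.refresh (m + 1)) (datumLp w₁ hw₁))))‖ ≤ 1 / 2 * ‖Q₂ (Um1 0 ((j : ℝ) * E.refresh (m + 1)) (datumLp w₁ hw₁))‖ + ε * ‖datumLp w₁ hw₁‖) :
    ∀ k (W : Literature.Analysis.FluidPDE.LatticeShear.LatticeWord k) (M : ℝ) (hM : 0 < M) (c : ℝ), 0 < c →
    ∀ (Φ : ℝ → Torus.Visc4 (Fin 3) → Torus.Visc4 (Fin 3)) (lo hi Λ β σ C ν₀ K Cf νf Kf : ℝ),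
      0 < lo → lo ≤ 1 → 1 ≤ hi → 1 < Λ → 0 ≤ β →
      0 < σ → 0 ≤ C → 0 < ν₀ → 0 < K → SlowVectorClauseF W M hM c Φ lo hi Λ β σ C ν₀ K →
      0 ≤ Cf → 0 < νf → 0 < Kf → CellEnergyClausesW W M hM c lo hi Λ β Cf νf Kf →
      (∀ Kb : ℝ, 1 ≤ Kb → ∃ CK : ℝ, 1 ≤ CK ∧ ∃ cK > (0:ℝ), ∃ νh > (0:ℝ), HighLabelDecayW W M hM lo hi Λ β νh Kb CK cK) →
      ∃ ν₁ > (0:ℝ), ∃ K₁ > (0:ℝ), ∃ Λ₀ : ℕ, ∃ θ₀ > (0:ℝ), ∃ Cw > (0:ℝ), ∃ σw > (0:ℝ),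
        ∀ E : Literature.Analysis.FluidPDE.LatticeShear.LagrangianLatticeCarrier k, E.design = W.stretch M hM → E.gain = c → E.nu0 ≤ ν₁ → K₁ ≤ E.K →
          E.LPermissible → E.Regular → (∀ m, Λ₀ * E.N m ≤ E.N (m + 1)) → (∀ m, E.N m ^ 2 ≤ E.N (m + 1)) →
          (∀ m, E.cellVisc (m + 1) * ((E.N (m + 1) : ℝ) / E.N m) ^ (1 / 4 : ℝ) ≤ 1) →
          (∀ m, E.K * ((E.N (m + 1) : ℝ) / E.N m) ^ (1 / 4 : ℝ) ≤ ((E.N (m + 1) : ℝ) / E.N m) * E.cellVisc (m + 1)) →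
          (∀ m, E.θ (m + 1) * ((E.N (m + 1) : ℝ) / E.N m) ^ (1 / 16 : ℝ) ≤ θ₀) →
          (∀ m, ((E.N (m + 1) : ℝ) / E.N m) ^ (1 / 16 : ℝ) * E.physPeriod (m + 1) ≤ E.refresh (m + 1)) →
        ∃ mstar : ℕ, ∀ m, mstar ≤ m →
          E.refresh (m + 1) ≤ 1 / 4 ∧
          ∀ Lc : ℕ, Lc = ⌊((E.N m : ℝ) / E.N (m + 1)) ^ (1 / 64 : ℝ) * (E.N (m + 1) * E.cellVisc (m + 1)) / Real.sqrt c⌋₊ →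
          ∀ S : Torus.Visc4 (Fin 3), Torus.OddSmall S β → Torus.NearIso S lo hi →
            Torus.OddSmall (Φ (E.cellVisc (m + 1)) S) β → Torus.NearIso (Φ (E.cellVisc (m + 1)) S) lo hi →
          ∀ Um Um1 : ℝ → ℝ → (V2 →L[ℝ] V2),
            Torus.IsPropagator 1 (E.partialSum m) (E.kbar m • renormStep (Φ (E.cellVisc (m + 1))) (E.gain / E.cellVisc (m + 1) ^ 2) S) Um →
            Torus.IsPropagator 1 (E.partialSum (m + 1)) (E.kbar (m + 1) • S) Um1 →
          ∀ ηm ε : ℝ, ηm = Cw * ((E.N m : ℝ) / E.N (m + 1)) ^ σw →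
            ε = ((E.N m : ℝ) / E.N (m + 1)) ^ σw * (1 - Real.exp (-(4 * Real.pi ^ 2 * (E.kbar m * lo)))) * E.refresh (m + 1) →
          ∃ P Q₁ Q₂ : V2 →L[ℝ] V2,
            (∀ y : V2, P y + Q₁ y + Q₂ y = y) ∧ (∀ y : V2, ‖y‖ ^ 2 = ‖P y‖ ^ 2 + ‖Q₁ y‖ ^ 2 + ‖Q₂ y‖ ^ 2) ∧
            (∀ y y' : V2, ⟪P y, Q₁ y' + Q₂ y'⟫_ℝ = 0) ∧
          ∀ (w₁ : VF) (hw₁ : IsDatum w₁), Torus.fourierTruncate Lc w₁ = w₁ →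
            Q₂ (datumLp w₁ hw₁) = 0 ∧
            ∀ (j : ℕ) (s' : ℝ), (j : ℝ) * E.refresh (m + 1) + E.refresh (m + 1) ≤ s' →
              s' ≤ (j : ℝ) * E.refresh (m + 1) + 2 * E.refresh (m + 1) → s' ≤ 1 →
            (∀ y : V2, |⟪y, P (Um1 ((j : ℝ) * E.refresh (m + 1)) s' (Um1 0 ((j : ℝ) * E.refresh (m + 1)) (datumLp w₁ hw₁)) - Um ((j : ℝ) * E.refresh (m + 1)) s' (Um1 0 ((j : ℝ) * E.refresh (m + 1)) (datumLp w₁ hw₁)))⟫_ℝ| ≤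
                ηm * Real.sqrt (‖Um1 0 ((j : ℝ) * E.refresh (m + 1)) (datumLp w₁ hw₁)‖ ^ 2 - ‖Um ((j : ℝ) * E.refresh (m + 1)) s' (Um1 0 ((j : ℝ) * E.refresh (m + 1)) (datumLp w₁ hw₁))‖ ^ 2) * Real.sqrt (‖y‖ ^ 2 - ‖ContinuousLinearMap.adjoint (Um ((j : ℝ) * E.refresh (m + 1)) s') y‖ ^ 2) + ε * ‖datumLp w₁ hw₁‖ * ‖y‖) ∧
            (∀ y : V2, ‖Um ((j : ℝ) * E.refresh (m + 1)) s' (Q₁ y + Q₂ y)‖ ≤ ε * ‖y‖ ∧ ‖Q₁ (Um ((j : ℝ) * E.refresh (m + 1)) s' y) + Q₂ (Um ((j : ℝ) * E.refresh (m + 1)) s' y)‖ ≤ ε * ‖y‖ ∧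
                ‖ContinuousLinearMap.adjoint (Um ((j : ℝ) * E.refresh (m + 1)) s') (Q₁ y + Q₂ y)‖ ≤ ε * ‖y‖) ∧
            ‖Q₁ (Um1 ((j : ℝ) * E.refresh (m + 1)) s' (P (Um1 0 ((j : ℝ) * E.refresh (m + 1)) (datumLp w₁ hw₁))))‖ ≤ Real.sqrt (ηm * (‖Um1 0 ((j : ℝ) * E.refresh (m + 1)) (datumLp w₁ hw₁)‖ ^ 2 - ‖Um ((j : ℝ) * E.refresh (m + 1)) s' (Um1 0 ((j : ℝ) * E.refresh (m + 1)) (datumLp w₁ hw₁))‖ ^ 2)) + ε * ‖datumLp w₁ hw₁‖ ∧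
            ‖Q₂ (Um1 ((j : ℝ) * E.refresh (m + 1)) s' (P (Um1 0 ((j : ℝ) * E.refresh (m + 1)) (datumLp w₁ hw₁))))‖ ≤ Real.sqrt (ηm * (‖Um1 0 ((j : ℝ) * E.refresh (m + 1)) (datumLp w₁ hw₁)‖ ^ 2 - ‖Um ((j : ℝ) * E.refresh (m + 1)) s' (Um1 0 ((j : ℝ) * E.refresh (m + 1)) (datumLp w₁ hw₁))‖ ^ 2)) + ε * ‖datumLp w₁ hw₁‖ ∧
            ‖Q₁ (Um1 ((j : ℝ) * E.refresh (m + 1)) s' (Q₁ (Um1 0 ((j : ℝ) * E.refresh (m + 1)) (datumLp w₁ hw₁))))‖ ≤ ηm * ‖Q₁ (Um1 0 ((j : ℝ) * E.refresh (m + 1)) (datumLp w₁ hw₁))‖ + ε * ‖datumLp w₁ hw₁‖ ∧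
            ‖Q₂ (Um1 ((j : ℝ) * E.refresh (m + 1)) s' (Q₁ (Um1 0 ((j : ℝ) * E.refresh (m + 1)) (datumLp w₁ hw₁))))‖ ≤ ηm * ‖Q₁ (Um1 0 ((j : ℝ) * E.refresh (m + 1)) (datumLp w₁ hw₁))‖ + ε * ‖datumLp w₁ hw₁‖ ∧
            ‖Q₁ (Um1 ((j : ℝ) * E.refresh (m + 1)) s' (Q₂ (Um1 0 ((j : ℝ) * E.refresh (m + 1)) (datumLp w₁ hw₁))))‖ ≤ ηm * ‖Q₂ (Um1 0 ((j : ℝ) * E.refresh (m + 1)) (datumLp w₁ hw₁))‖ + ε * ‖datumLp w₁ hw₁‖ ∧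
            ‖Q₂ (Um1 ((j : ℝ) * E.refresh (m + 1)) s' (Q₂ (Um1 0 ((j : ℝ) * E.refresh (m + 1)) (datumLp w₁ hw₁))))‖ ≤ 1 / 2 * ‖Q₂ (Um1 0 ((j : ℝ) * E.refresh (m + 1)) (datumLp w₁ hw₁))‖ + ε * ‖datumLp w₁ hw₁‖ := by
  intro k W M hM c hc Φ lo hi Λ β σ C ν₀ K Cf νf Kf hlo hlo1 hhi hΛ hβ hσ hC hν₀ hK hV hCf hνf hKf hF hH
  obtain ⟨C₂, hC₂, θ₁, hθ₁, c₃, hc₃, hW⟩ := hW3E k W M hM c hc Φ lo hi β hlo hlo1 hhi hβ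
  obtain ⟨ν₁, hν₁, K₁, hK₁, Λ₀, θ₀, hθ₀, Cz, hCz, σz, hσz, hcell⟩ :=
    hCell k W M hM c hc Φ lo hi Λ β σ C ν₀ K Cf νf Kf hlo hlo1 hhi hΛ hβ hσ hC hν₀ hK hV hCf hνf hKf hF hH
  refine ⟨ν₁, hν₁, K₁, hK₁, Λ₀, θ₀, hθ₀, 10 * Cz, by positivity, σz, hσz, ?_⟩
  intro E hdes hgain hnu0 hKE hLP hReg hT1 hN2 hT2 hT3 hT4 hT5
  have hP : E.toFractalCarrierData.Permissible := hLP.1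
  obtain ⟨m₁, hm₁⟩ := hcell E hdes hgain hnu0 hKE hLP hReg hT1 hN2 hT2 hT3 hT4 hT5
  obtain ⟨m₂, hm₂⟩ := hi_tails_le_eps E hdes hLP hN2 hT2 hT3 hθ₀ hT4 hT5 σz hlo hc hC₂ hc₃
  obtain ⟨m₃, hm₃⟩ := exists_forall_le_sep16 E.toFractalCarrierData hP hN2 (θ₀ / θ₁)
  obtain ⟨m₄, hm₄⟩ := off_ball_rate_ge_one E hdes hLP hN2 hT3 hT5 hlo hc
  refine ⟨max m₁ (max m₂ (max m₃ m₄)), fun m hm => ?_⟩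
  have hm1 : m₁ ≤ m := le_trans (le_max_left _ _) hm
  have hm2 : m₂ ≤ m := le_trans ((le_max_left _ _).trans (le_max_right _ _)) hm
  have hm3 : m₃ ≤ m := le_trans (((le_max_left _ _).trans (le_max_right _ _)).trans (le_max_right _ _)) hm
  have hm4 : m₄ ≤ m := le_trans (((le_max_right _ _).trans (le_max_right _ _)).trans (le_max_right _ _)) hm
  obtain ⟨hr4, hfacts⟩ := hm₁ m hm1
  refine ⟨hr4, ?_⟩
  intro Lc hLc S hS₁ hS₂ hS₃ hS₄ Um Um1 hUm hUm1 ηm ε hηm hε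
  obtain ⟨A, B, Cset, hA, hB, hCs, hAB, hAC, hBC, hcov, hBCf, hCf', hwin⟩ :=
    hfacts Lc hLc S hS₁ hS₂ hS₃ hS₄ Um Um1 hUm hUm1 (Cz * ((E.N m : ℝ) / E.N (m + 1)) ^ σz) ε rfl hε
  obtain ⟨P, Q₁, Q₂, hPQ, hpyth, horth, hPc, hQ₁c, hQ₂c⟩ := exists_labelSplit A B Cset hA hB hCs hAB hAC hBC hcov
  refine ⟨P, Q₁, Q₂, hPQ, hpyth, horth, ?_⟩
  intro w₁ hw₁ hband
  refine ⟨labelProj_datum_eq_zero hCf' hQ₂c w₁ hw₁ hband, ?_⟩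
  intro j s' h1 h2 h3
  obtain ⟨hZin, hR1, hR2, hR3, hR4, hR5, hR6⟩ := hwin P Q₁ Q₂ hPc hQ₁c hQ₂c w₁ hw₁ hband j s' h1 h2 h3
  -- elementary facts about the window
  have hr : 0 < E.refresh (m + 1) := E.refresh_pos (m + 1)
  have hs0 : 0 ≤ (j : ℝ) * E.refresh (m + 1) := by positivity
  have hss' : (j : ℝ) * E.refresh (m + 1) ≤ s' := by linarith
  have hlen : s' - (j : ℝ) * E.refresh (m + 1) ≤ 2 * E.refresh (m + 1) := by linarith
  have hτr : E.refresh (m + 1) ≤ s' - (j : ℝ) * E.refresh (m + 1) := by linarith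
  have hτ : 0 < s' - (j : ℝ) * E.refresh (m + 1) := by linarith
  have hρ0 : 0 < (E.N m : ℝ) / E.N (m + 1) := div_pos (by exact_mod_cast E.N_pos m) (by exact_mod_cast E.N_pos (m + 1))
  have hρσ : 0 < ((E.N m : ℝ) / E.N (m + 1)) ^ σz := Real.rpow_pos_of_pos hρ0 _
  have hηz : 0 < Cz * ((E.N m : ℝ) / E.N (m + 1)) ^ σz := mul_pos hCz hρσ
  have hηzm : Cz * ((E.N m : ℝ) / E.N (m + 1)) ^ σz ≤ ηm := by rw [hηm]; nlinarith
  have h10 : 10 * (Cz * ((E.N m : ℝ) / E.N (m + 1)) ^ σz) ≤ ηm := by rw [hηm, mul_assoc]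
  have hkl : 0 ≤ 4 * Real.pi ^ 2 * (E.kbar m * lo) := by have := E.kbar_pos m; positivity
  have hε0 : 0 ≤ ε := by
    rw [hε]
    refine mul_nonneg (mul_nonneg hρσ.le ?_) hr.le
    rw [sub_nonneg]; exact Real.exp_le_one_iff.2 (by linarith)
  -- `θ(m+1) ≤ θ₁` from (T4) and `s_m ≥ θ₀/θ₁`
  have hθ : E.θ (m + 1) ≤ θ₁ := by
    have h16 := hm₃ m hm3
    have hsep := sep16_pos E.toFractalCarrierData m
    have h4 := hT4 m
    rw [div_le_iff₀ hθ₁, mul_comm] at h16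
    exact le_of_mul_le_mul_right (h4.trans h16) hsep
  -- W3-E on this window, for `T` and `T†`
  obtain ⟨hiT, hoT, hnT⟩ := hW E hdes hgain hLP hReg m hθ S hS₃ hS₄ Um hUm ((j : ℝ) * E.refresh (m + 1)) s' hs0 hss' h3 hlen
    (Um ((j : ℝ) * E.refresh (m + 1)) s') (Or.inl rfl)
  obtain ⟨hiA, -, hnA⟩ := hW E hdes hgain hLP hReg m hθ S hS₃ hS₄ Um hUm ((j : ℝ) * E.refresh (m + 1)) s' hs0 hss' h3 hlen
    (adjoint (Um ((j : ℝ) * E.refresh (m + 1)) s')) (Or.inr rfl)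
  -- (Hi)
  have hgap : 2 * (Lc / 2 / 2) ≤ Lc / 2 := Nat.mul_div_le (Lc / 2) 2
  have hεt := hm₂ m hm2 (s' - (j : ℝ) * E.refresh (m + 1)) hτr Lc (Lc / 2) (Lc / 2 / 2) hLc rfl rfl
  rw [← hε] at hεt
  have hBCf' : ∀ k' ∈ B ∪ Cset, (((Lc / 2 : ℕ) : ℝ)) ^ 2 < Torus.freqNormSq k' :=
    fun k' hk' => hBCf k' ((Set.mem_union _ _ _).1 hk')
  have hQc := proj_add_char hBC hQ₁c hQ₂c
  have hHi : ∀ y : V2, ‖Um ((j : ℝ) * E.refresh (m + 1)) s' (Q₁ y + Q₂ y)‖ ≤ ε * ‖y‖ ∧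
      ‖Q₁ (Um ((j : ℝ) * E.refresh (m + 1)) s' y) + Q₂ (Um ((j : ℝ) * E.refresh (m + 1)) s' y)‖ ≤ ε * ‖y‖ ∧
      ‖adjoint (Um ((j : ℝ) * E.refresh (m + 1)) s') (Q₁ y + Q₂ y)‖ ≤ ε * ‖y‖ := by
    intro y
    have h := hi_of_bandKill (L' := Lc / 2 / 2) (L := Lc / 2) hBCf' (Q := Q₁ + Q₂)
      (fun y' k' => by rw [hQc y' k']; congr 1) (Um ((j : ℝ) * E.refresh (m + 1)) s')
      (Real.exp_nonneg _) (add_nonneg (Real.exp_nonneg _) (Real.exp_nonneg _))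
      (hoT (Lc / 2 / 2) (Lc / 2) hgap) (hnT (Lc / 2 / 2) (Lc / 2) hgap) (hnA (Lc / 2 / 2) (Lc / 2) hgap) y
    rw [show (Q₁ + Q₂) y = Q₁ y + Q₂ y from rfl] at h
    obtain ⟨h1', h2', h3'⟩ := h
    have hy := norm_nonneg y
    exact ⟨h1'.trans (mul_le_mul_of_nonneg_right hεt hy), h2'.trans (mul_le_mul_of_nonneg_right hεt hy),
      h3'.trans (mul_le_mul_of_nonneg_right hεt hy)⟩
  -- (Z): zero modes
  obtain ⟨P₀, hP₀⟩ := exists_zeroModeProj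
  have hgain0 : 0 ≤ E.gain := hgain ▸ hc.le
  have h𝔸v : Torus.NearIso (E.kbar m • renormStep (Φ (E.cellVisc (m + 1))) (E.gain / E.cellVisc (m + 1) ^ 2) S)
      (E.kbar m * lo) (E.kbar m * hi) :=
    (nearIso_renormStep (div_nonneg hgain0 (sq_nonneg _)) hS₂ hS₄).smul (E.kbar_pos m).le
  have h𝔸1 : Torus.NearIso (E.kbar (m + 1) • S) (E.kbar (m + 1) * lo) (E.kbar (m + 1) * hi) := hS₂.smul (E.kbar_pos (m + 1)).le
  have hklo : 0 < E.kbar m * lo := mul_pos (E.kbar_pos m) hlo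
  have hklo1 : 0 < E.kbar (m + 1) * lo := mul_pos (E.kbar_pos (m + 1)) hlo
  have hx_div : Torus.IsWeaklyDivFree ((datumLp w₁ hw₁ : V2) : VF) := isWeaklyDivFree_datumLp w₁ hw₁
  have hs1 : (j : ℝ) * E.refresh (m + 1) ≤ 1 := hss'.trans h3
  have hu0 : mFourierCoeff (EuclideanSpace.complexify ∘ ⇑(Um1 0 ((j : ℝ) * E.refresh (m + 1)) (datumLp w₁ hw₁))) 0 = 0 := by
    rw [fcoeff_zero_apply_eq E hReg (m + 1) hklo1 h𝔸1 hUm1 le_rfl hs0 hs1 (datumLp w₁ hw₁) hx_div]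
    exact fcoeff_zero_datumLp w₁ hw₁
  have hu_div : Torus.IsWeaklyDivFree ((Um1 0 ((j : ℝ) * E.refresh (m + 1)) (datumLp w₁ hw₁) : V2) : VF) :=
    hUm1.divFree 0 _ (datumLp w₁ hw₁)
  have hUu := fcoeff_zero_apply_eq E hReg (m + 1) hklo1 h𝔸1 hUm1 hs0 hss' h3 _ hu_div
  have hTu := fcoeff_zero_apply_eq E hReg m hklo h𝔸v hUm hs0 hss' h3 _ hu_div
  have he0 : mFourierCoeff (EuclideanSpace.complexify ∘ ⇑(P (Um1 ((j : ℝ) * E.refresh (m + 1)) s'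
      (Um1 0 ((j : ℝ) * E.refresh (m + 1)) (datumLp w₁ hw₁))
      - Um ((j : ℝ) * E.refresh (m + 1)) s' (Um1 0 ((j : ℝ) * E.refresh (m + 1)) (datumLp w₁ hw₁))))) 0 = 0 := by
    rw [hPc, fcoeff_sub, hUu, hTu, sub_self]; simp
  obtain ⟨e_d, e_c, e_l, e_f, hsplit, hdS, hlS, hfS, hdiag, hcross, hleak, hfast⟩ := hZin
  -- (Z): rates
  have hν : 0 < E.cellVisc (m + 1) := cellVisc_pos' E.toFractalCarrierData (m + 1)
  have hNn : (0 : ℝ) < E.N (m + 1) := by exact_mod_cast E.N_pos (m + 1)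
  have ha : 0 < E.a (m + 1) := E.a_pos (m + 1)
  have hrate0 : ∀ k' : Fin 3 → ℤ, 0 ≤ E.a (m + 1) * (8 * Real.pi ^ 2 * ‖Torus.latticeVec k'‖ ^ 2 * lo
      * (E.cellVisc (m + 1) + c / E.cellVisc (m + 1)) / (E.N (m + 1) : ℝ) ^ 2) := fun k' => by positivity
  have hrate : ∀ k' : Fin 3 → ℤ, k' ≠ 0 → 0 < E.a (m + 1) * (8 * Real.pi ^ 2 * ‖Torus.latticeVec k'‖ ^ 2 * lo
      * (E.cellVisc (m + 1) + c / E.cellVisc (m + 1)) / (E.N (m + 1) : ℝ) ^ 2) := fun k' hk' => by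
    have hk2 : 0 < ‖Torus.latticeVec k'‖ ^ 2 := by rw [Torus.norm_latticeVec_sq]; exact Torus.freqNormSq_pos_of_ne_zero hk'
    positivity
  have hoff := hm₄ m hm4 (s' - (j : ℝ) * E.refresh (m + 1)) hτr Lc hLc
  have hZ : ∀ y : V2, |⟪y, P (Um1 ((j : ℝ) * E.refresh (m + 1)) s' (Um1 0 ((j : ℝ) * E.refresh (m + 1)) (datumLp w₁ hw₁))
      - Um ((j : ℝ) * E.refresh (m + 1)) s' (Um1 0 ((j : ℝ) * E.refresh (m + 1)) (datumLp w₁ hw₁)))⟫_ℝ| ≤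
      ηm * Real.sqrt (‖Um1 0 ((j : ℝ) * E.refresh (m + 1)) (datumLp w₁ hw₁)‖ ^ 2
        - ‖Um ((j : ℝ) * E.refresh (m + 1)) s' (Um1 0 ((j : ℝ) * E.refresh (m + 1)) (datumLp w₁ hw₁))‖ ^ 2)
      * Real.sqrt (‖y‖ ^ 2 - ‖adjoint (Um ((j : ℝ) * E.refresh (m + 1)) s') y‖ ^ 2) + ε * ‖datumLp w₁ hw₁‖ * ‖y‖ := fun y =>
    z_block (Lc / 2) ((Torus.freqBall (Lc / 2)).erase 0) rfl (Um ((j : ℝ) * E.refresh (m + 1)) s')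
      (Um1 ((j : ℝ) * E.refresh (m + 1)) s') P P₀ (Um1 0 ((j : ℝ) * E.refresh (m + 1)) (datumLp w₁ hw₁)) y e_d e_c e_l e_f
      (fun k' => E.a (m + 1) * (8 * Real.pi ^ 2 * ‖Torus.latticeVec k'‖ ^ 2 * lo * (E.cellVisc (m + 1) + c / E.cellVisc (m + 1))
        / (E.N (m + 1) : ℝ) ^ 2))
      hP₀ hsplit he0 hu0 hrate0 hrate hτ hoff (hiT _) (hiA y) hdS hlS hfS hdiag hcross hleak hfast hηz h10 (by positivity)
  -- (Rec)
  have hD0 : 0 ≤ ‖Um1 0 ((j : ℝ) * E.refresh (m + 1)) (datumLp w₁ hw₁)‖ ^ 2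
      - ‖Um ((j : ℝ) * E.refresh (m + 1)) s' (Um1 0 ((j : ℝ) * E.refresh (m + 1)) (datumLp w₁ hw₁))‖ ^ 2 := by
    have h := hUm.norm_le ((j : ℝ) * E.refresh (m + 1)) s' (Um1 0 ((j : ℝ) * E.refresh (m + 1)) (datumLp w₁ hw₁))
    nlinarith [norm_nonneg (Um ((j : ℝ) * E.refresh (m + 1)) s' (Um1 0 ((j : ℝ) * E.refresh (m + 1)) (datumLp w₁ hw₁)))]
  have hsq := Real.sqrt_le_sqrt (mul_le_mul_of_nonneg_right hηzm hD0)
  have hQ1 := mul_le_mul_of_nonneg_right hηzm (norm_nonneg (Q₁ (Um1 0 ((j : ℝ) * E.refresh (m + 1)) (datumLp w₁ hw₁))))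
  have hQ2 := mul_le_mul_of_nonneg_right hηzm (norm_nonneg (Q₂ (Um1 0 ((j : ℝ) * E.refresh (m + 1)) (datumLp w₁ hw₁))))
  exact ⟨hZ, hHi, hR1.trans (add_le_add hsq le_rfl), hR2.trans (add_le_add hsq le_rfl),
    hR3.trans (add_le_add hQ1 le_rfl), hR4.trans (add_le_add hQ1 le_rfl), hR5.trans (add_le_add hQ2 le_rfl), hR6⟩

end Summit.AnomalousDissipation.AnomalousDissipation.Theorems.SolenoidalFractalHomogenisation.LagrangianStep
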